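import Mathlib
import Literature.NumberTheory.Transcendental.KZCalculus
import Summits.KontsevichZagierPeriods.KontsevichZagierPeriods.Theses.UnfoldedStokes
import Summits.KontsevichZagierPeriods.KontsevichZagierPeriods.Theorems.UnfoldedStokesLegendreCubicFormStubInjOn
import Summits.KontsevichZagierPeriods.KontsevichZagierPeriods.Theorems.UnfoldedStokesLegendreCubicFormStubImage
import Summits.KontsevichZagierPeriods.KontsevichZagierPeriods.Theorems.UnfoldedStokesLegendreCubicFormStubJacobian
import Summits.KontsevichZagierPeriods.KontsevichZagierPeriods.Theorems.UnfoldedStokesLegendreCubicFormStubTransfer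
import Summits.KontsevichZagierPeriods.KontsevichZagierPeriods.Theorems.UnfoldedStokesLegendreCubicFormStubHeightNL
import Summits.KontsevichZagierPeriods.KontsevichZagierPeriods.Theorems.UnfoldedStokesLegendreCubicFormStubArctanTail

/-!
# `LegendreCubicForm` (stmt-KontsevichZagierPeriods-3521, route UnfoldedStokes): Legendre's relation in single-curve interval form

For rational `e₁ < e₂ < e₃` and `P(x) = (x−e₁)(x−e₂)(x−e₃)`, the two-dimensional Kontsevich–Zagier
representation `[(e₁,e₂)×(e₂,e₃), (μ−λ)/√(|P(λ)||P(μ)|)]` (value `I₁⁰I₂¹ − I₂⁰I₁¹ = 2π`, Legendre's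
relation `η₂ω₁ − η₁ω₂ = 2πi` of the elliptic curve `y² = P(x)`) is KZ-EQUIVALENT — i.e. joined by a finite
chain of the calculus moves additivity / change of variables / Newton–Leibniz of
`Literature.NumberTheory.Transcendental.KZ` — to `[ℝ, 2/(1+x²)]`.

The chain (line `Sketch`, hat-box chart; crux directory `Cruxes/LegendreCubicForm/`):

* M1, ONE change of variables (rule 2): the hat-box map
  `Λ(λ,μ) = (u,z) = (√((e₃−e₁)(e₂−λ)(μ−e₂)/((e₃−e₂)(λ−e₁)(μ−e₁))), √((e₃−λ)(e₃−μ)/((e₃−e₁)(e₃−e₂))))` —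
  tangent of the azimuth and height of the point of `S²` with sphero-conal coordinates `(λ,μ)` — is a
  bijection of the open rectangle onto `(0,∞)×(0,1)` with `g = (4/(1+u²))∘Λ·|det DΛ|` (Archimedes'
  hat-box theorem `dA_{S²} = dθ dz`): `stub_hatBoxInjOn`, `stub_hatBoxImage`, `stub_hatBoxJacobian`,
  packaged by `stub_hatBoxTransfer`;
* M2, height integration (rules 1, 3): `[(0,∞)×(0,1), 4/(1+u²)] ~ [(0,∞), 4/(1+u²)]`, one Newton–Leibniz
  move with the polynomial primitive `4z/(1+u²)`: `stub_heightNewtonLeibniz`;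
* M3–M6, the arctangent tail (rules 1, 2): `[(0,∞), 4/(1+x²)] ~ [ℝ, 2/(1+x²)]`: `stub_arctanTail`.

No elliptic integrand is ever integrated in its own variable (the barrier
`Literature.Barriers.KontsevichZagierPeriods.noSemialgebraicPrimitive_inv_sub_two` is not engaged); no named
fact is used. References: M. Kontsevich, D. Zagier, *Periods* (2001), §1.1–1.2; E. T. Whittaker,
G. N. Watson, *A Course of Modern Analysis* (1927), §20.411 (Legendre's relation); A. V. Bolsinov,
A. T. Fomenko, *Integrable Hamiltonian Systems* (2004), §13.3.2 (sphero-conical coordinates); Archimedes,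
*On the Sphere and Cylinder* I.
-/

-- `Summit.<Summit>.<Sub>` with Sub = Summit (single-conjunct summit, D-0017) duplicates the segment.
set_option linter.dupNamespace false

noncomputable section

namespace Summit.KontsevichZagierPeriods.KontsevichZagierPeriods.Theorems

open Set MeasureTheory
open Literature.NumberTheory.Transcendental
open Summit.KontsevichZagierPeriods.UnfoldedStokes.LegendreCubicFormLine

/-- **Legendre's relation in single-curve interval form** (crux `LegendreCubicForm`,
stmt-KontsevichZagierPeriods-3521): for rational `e₁ < e₂ < e₃` the representation
`[(e₁,e₂)×(e₂,e₃), (μ−λ)/√(|P(λ)||P(μ)|)]` is KZ-equivalent to `[ℝ, 2/(1+x²)]` — one hat-box change of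
variables, one Newton–Leibniz move in the height, and the arctangent tail.
[cite: KontsevichZagier2001, §1.2] -/
theorem LegendreCubicForm_of :
    Summit.KontsevichZagierPeriods.KontsevichZagierPeriods.Theses.UnfoldedStokes.LegendreCubicForm := by
  intro e₁ e₂ e₃ h12 h23 r r' hrd hri hr'd hr'i
  obtain ⟨p, hpd, hpi, hcov⟩ :=
    stub_hatBoxTransfer e₁ e₂ e₃ h12 h23 (stub_hatBoxInjOn e₁ e₂ e₃ h12 h23)
      (stub_hatBoxImage e₁ e₂ e₃ h12 h23) (stub_hatBoxJacobian e₁ e₂ e₃ h12 h23) r hrd hri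
  have hrp : KZ.Equivalent r p := KZ.changeOfVariablesRel_subset_relations hcov
  obtain ⟨q, hqd, hqi, hpq⟩ := stub_heightNewtonLeibniz p hpd (by rw [hpi]; exact fun _ _ => rfl)
  have hqr' : KZ.Equivalent q r' := stub_arctanTail q r' hqd (by rw [hqi]; exact fun _ _ => rfl) hr'd hr'i
  exact (hrp.trans hpq).trans hqr'

end Summit.KontsevichZagierPeriods.KontsevichZagierPeriods.Theorems
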